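import Summits.Ventures.PercRepro.RankLevelSetRuleQSliceBorderDensity
import Summits.Ventures.PercRepro.RankLevelSetRuleQSliceIdentity

/-!
# PercRepro — THE DENSITY COMPARISON FOR EVERY SLICE; EVERY SLICE FROM `T_u ≤ 1` (night-1, gen 21; dossier §32.1)

`rho_density_ge` (gen 20, the borderline `u = k − 2`) generalises verbatim: with `q = m + u`, the two partial-row ratios of the
slice identity compare TERMWISE,
* **`rho_density_ge_slice (m u k) (m·k ≤ m·u + u² + u) : ρ(2m+u, m) ≤ ρ(2q+k, q)`** — every factor `(q − t)/(q + k + 1 + t)` of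
  the second dominates the factor `(m − t)/(m + u + 1 + t)` of the first (the cross difference is `u(m+u+1+t) − (m−t)k`), and the
  second sum has more terms; at `u = k − 2` the condition is `2m ≤ (k−2)(k−1)` (gen 20), at `u = k − 1` it is `m ≤ (k−1)k`, and for
  `u ≥ k` it is empty;
* **`phiK_le_rhat_of_sliceTail_le_one`** — on that range the slice `u` is paid as soon as its tail is at most `1`:
  `sliceTail u k m ≤ 1 ⇒ Φ(q+k, q) ≤ R̂(q, k, m)` (`k ≥ 1`).
Axioms: standard.
-/

namespace PercRepro

open Finset

/-- **THE DENSITY COMPARISON FOR EVERY SLICE**: with `q = m + u` and `m·k ≤ m·u + u² + u`,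
`ρ(2m+u, m) ≤ ρ(2q+k, q)` — termwise, every factor `(q − t)/(q + k + 1 + t)` dominates `(m − t)/(m + u + 1 + t)`. -/
theorem rho_density_ge_slice (m u k : ℕ) (h : m * k ≤ m * u + u * u + u) :
    (∑ i ∈ range (m + 1), ((2 * m + u).choose i : ℚ)) / ((2 * m + u).choose m : ℚ)
      ≤ (∑ i ∈ range (m + u + 1), ((2 * (m + u) + k).choose i : ℚ)) / ((2 * (m + u) + k).choose (m + u) : ℚ) := by
  rw [rho_as_prod_sum (2 * m + u) m (by omega), rho_as_prod_sum (2 * (m + u) + k) (m + u) (by omega)]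
  have hu : (0 : ℚ) ≤ u := by positivity
  have hk : (0 : ℚ) ≤ k := by positivity
  have hm0 : (0 : ℚ) ≤ m := by positivity
  have hcond : (m : ℚ) * k ≤ (m : ℚ) * u + (u : ℚ) * u + u := by exact_mod_cast h
  have hterm : ∀ s ∈ range (m + 1),
      ∏ t ∈ range s, (((m : ℚ) - t) / (((2 * m + u : ℕ) : ℚ) - m + 1 + t))
        ≤ ∏ t ∈ range s, ((((m + u : ℕ) : ℚ) - t) / (((2 * (m + u) + k : ℕ) : ℚ) - ((m + u : ℕ) : ℚ) + 1 + t)) := by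
    intro s hs
    rw [Finset.mem_range] at hs
    apply Finset.prod_le_prod
    · intro t ht
      rw [Finset.mem_range] at ht
      have ht0 : (0 : ℚ) ≤ t := by positivity
      apply div_nonneg
      · have : (t : ℚ) ≤ m := by exact_mod_cast (by omega : t ≤ m)
        linarith
      · push_cast; linarith
    · intro t ht
      rw [Finset.mem_range] at ht
      have ht' : (t : ℚ) ≤ m := by exact_mod_cast (by omega : t ≤ m)
      have ht0 : (0 : ℚ) ≤ t := by positivity
      push_cast
      rw [div_le_div_iff₀ (by linarith) (by linarith)]
      nlinarith [hcond, mul_nonneg ht0 hu, mul_nonneg ht0 hk]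
  calc ∑ s ∈ range (m + 1), ∏ t ∈ range s, (((m : ℚ) - t) / (((2 * m + u : ℕ) : ℚ) - m + 1 + t))
      ≤ ∑ s ∈ range (m + 1), ∏ t ∈ range s,
          ((((m + u : ℕ) : ℚ) - t) / (((2 * (m + u) + k : ℕ) : ℚ) - ((m + u : ℕ) : ℚ) + 1 + t)) :=
        Finset.sum_le_sum hterm
    _ ≤ ∑ s ∈ range (m + u + 1), ∏ t ∈ range s,
          ((((m + u : ℕ) : ℚ) - t) / (((2 * (m + u) + k : ℕ) : ℚ) - ((m + u : ℕ) : ℚ) + 1 + t)) := by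
        apply Finset.sum_le_sum_of_subset_of_nonneg (Finset.range_mono (by omega))
        intro s hs _
        rw [Finset.mem_range] at hs
        apply Finset.prod_nonneg
        intro t ht
        rw [Finset.mem_range] at ht
        have ht0 : (0 : ℚ) ≤ t := by positivity
        apply div_nonneg
        · push_cast
          have : (t : ℚ) ≤ (m : ℚ) + u := by exact_mod_cast (by omega : t ≤ m + u)
          linarith
        · push_cast; linarith

/-- **EVERY SLICE FROM `T_u ≤ 1`**: `k ≥ 1`, `m·k ≤ m·u + u² + u` and `sliceTail u k m ≤ 1` ⇒ `Φ(q+k, q) ≤ R̂(q, k, m)` (`q = m + u`). -/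
theorem phiK_le_rhat_of_sliceTail_le_one (u k m : ℕ) (hk : 1 ≤ k) (hd : m * k ≤ m * u + u * u + u)
    (hT : sliceTail u k m ≤ 1) :
    phiK (m + u + k) (m + u) ≤ rhat (m + u) k m := by
  apply phiK_le_rhat_of_sliceTail u k m hk
  have := rho_density_ge_slice m u k hd
  linarith

end PercRepro
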